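import Literature.NumberTheory.Transcendental.FormIntegrationProofs
import Literature.NumberTheory.Transcendental.FormIntegrationAddProofs
import Mathlib.Analysis.Calculus.LineDeriv.IntegrationByParts
import HarnessLib

/-!
# Stokes' theorem on a closed oriented manifold: `∫_M dβ = 0`

Topic: integration of differential forms (Warner (1983), §4.8–4.9; Lee (2013), Ch. 16). This
file discharges the named facts
`Literature.Geometry.Kaehler.MForm.integral_eq_zero_of_mem_exactSmoothForms` and
`Literature.Geometry.Kaehler.MForm.integral_mextDeriv_eq_zero` of
`Literature/NumberTheory/Transcendental/FormIntegration.lean`: on a compact boundaryless manifold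
with a continuous orientation family `o`, the integral `MForm.integral o` of the exterior
derivative of a smooth `m`-form (`finrank ℝ E = m + 1`) vanishes, hence so does the integral of
every exact smooth top form (Warner (1983), Corollary to Thm. 4.9 (Stokes' Theorem II, with
`∂M = ∅`); Lee (2013), Thm. 16.11 / Cor. 16.13).

## Main statements (all proved)

* `Literature.NumberTheory.Transcendental.integral_fderiv_apply_eq_zero`,
  `Literature.NumberTheory.Transcendental.integral_extDeriv_apply_eq_zero`: the flat case — the
  integral over a finite-dimensional space (Haar measure) of a directional derivative of a
  compactly supported `C¹` function, and of `dη (v)` for a compactly supported `C¹` form `η`,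
  vanishes (Lee (2013), proof of Thm. 16.11, case `M = ℝⁿ`; here from Mathlib's integration by
  parts `integral_mul_fderiv_eq_neg_fderiv_mul_of_integrable` against the constant `1`).
* `Literature.Geometry.Kaehler.MForm.integral_finset_sum_of_isSmoothForm`: additivity of `∫_M`
  over finite sums of smooth top forms (Lee (2013), Prop. 16.6(a)), iterating the discharged
  named fact `MForm.integral_add` (`MForm.integral_add_holds` of `FormIntegrationAddProofs`).
* `Literature.NumberTheory.Transcendental.exists_ofChart_eq_smul`: a smooth form times a smooth
  function supported in a chart source is `MForm.ofChart p η` for a smooth compactly supported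
  form `η` on the model space.
* `Literature.NumberTheory.Transcendental.integral_mextDeriv_smul_eq_zero`: Stokes for a form
  supported in one oriented chart (`mextDeriv_ofChart`, `MForm.integral_ofChart_smul` and the flat
  case).
* `Literature.NumberTheory.Transcendental.integral_mextDeriv_eq_zero_of_isSmoothForm`:
  **Stokes' theorem on a closed manifold**, `∫_M dβ = 0`, by a finite smooth partition of unity
  subordinate to oriented coordinate balls (`exists_chartSign_const_ball`) and `d (∑ ψᵢ β) = ∑ d (ψᵢ β)`.
* `Literature.Geometry.Kaehler.MForm.integral_mextDeriv_eq_zero_holds`,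
  `Literature.Geometry.Kaehler.MForm.integral_eq_zero_of_mem_exactSmoothForms_holds`: the two named
  facts.

## Proof architecture (vs. Warner / Lee)

Warner (4.9) and Lee (16.11) reduce to forms supported in one oriented chart by a partition of
unity `{ψᵢ}` and linearity of `∫_M`, compute `∫_M d(ψᵢβ)` in that chart as the integral over
`ℝⁿ` of the exterior derivative of a compactly supported form, and conclude by the fundamental
theorem of calculus. Here: linearity of `∫_M` on smooth forms is
`MForm.integral_finset_sum_of_isSmoothForm` (from `MForm.integral_add_holds`);
`d β = ∑ᵢ d (ψᵢ β)` replaces Lee's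
`∑ᵢ dψᵢ ∧ β = 0`; the single-chart computation is `MForm.integral_ofChart_smul` (change of
variables, from `FormIntegrationCharts`) after writing `ψᵢ β = ofChart pᵢ ηᵢ` and
`d (ofChart pᵢ ηᵢ) = ofChart pᵢ (dηᵢ)`; the flat case is integration by parts against `1`.

## References

* F. W. Warner, *Foundations of Differentiable Manifolds and Lie Groups*, GTM 94, Springer
  (1983), 4.8 Integration on an oriented manifold (pp. 145–148), Thm. 4.9 (Stokes' Theorem II)
  and its Corollary `∫_M dω = 0` for `M` compact oriented (pp. 148–149).
* J. M. Lee, *Introduction to Smooth Manifolds*, 2nd ed., GTM 218, Springer (2013), Prop. 15.6,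
  Prop. 16.5–16.6, Thm. 16.11 (Stokes, p. 411), Cor. 16.13 (integrals of exact forms, p. 413).
-/

noncomputable section

open scoped Manifold ContDiff Topology
open Bundle Set Module MeasureTheory Function Filter

namespace Literature.NumberTheory.Transcendental

/-! ### The flat case: integrals of derivatives of compactly supported functions vanish -/

section Flat

variable {F : Type*} [NormedAddCommGroup F] [NormedSpace ℝ F] [FiniteDimensional ℝ F]
  [MeasurableSpace F] [BorelSpace F] (μ : Measure F) [μ.IsAddHaarMeasure]

/-- The integral (against a Haar measure on a finite-dimensional real vector space) of a
directional derivative of a compactly supported `C¹` function vanishes: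
`∫ ∂ᵥf = 0` (the case `M = ℝⁿ` of Stokes' theorem, Lee (2013), proof of Thm. 16.11; obtained
from Mathlib's integration by parts formula against the constant function `1`).
[cite: LeeSmoothManifolds2013, Thm. 16.11] -/
theorem integral_fderiv_apply_eq_zero {f : F → ℝ} (hf : ContDiff ℝ 1 f)
    (hfc : HasCompactSupport f) (v : F) : ∫ x, fderiv ℝ f x v ∂μ = 0 := by
  have hcont : Continuous fun x ↦ fderiv ℝ f x v :=
    (hf.continuous_fderiv one_ne_zero).clm_apply continuous_const
  have hint : Integrable (fun x ↦ fderiv ℝ f x v) μ :=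
    hcont.integrable_of_hasCompactSupport (hfc.fderiv_apply (𝕜 := ℝ) v)
  have h := integral_mul_fderiv_eq_neg_fderiv_mul_of_integrable (μ := μ) (f := f)
    (g := fun _ : F ↦ (1 : ℝ)) (v := v) (by simpa using hint) (by simp)
    (by simpa using hf.continuous.integrable_of_hasCompactSupport hfc)
    (fun x _ ↦ hf.differentiable one_ne_zero x) (fun x _ ↦ differentiableAt_const _)
  simpa using h

omit [FiniteDimensional ℝ F] [MeasurableSpace F] [BorelSpace F] in
/-- The exterior derivative of a `C^∞` form is `C^∞`. [folklore] -/
theorem contDiff_extDeriv {k : ℕ} {η : F → F [⋀^Fin k]→L[ℝ] ℝ} (hη : ContDiff ℝ ∞ η) :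
    ContDiff ℝ ∞ (extDeriv η) := by
  have : extDeriv η = fun x ↦
      ContinuousAlternatingMap.alternatizeUncurryFinCLM ℝ F ℝ (fderiv ℝ η x) := by
    funext x
    rfl
  rw [this]
  exact (ContinuousAlternatingMap.alternatizeUncurryFinCLM ℝ F ℝ).contDiff.comp
    (hη.fderiv_right (m := ∞) (by simp))

omit [FiniteDimensional ℝ F] [MeasurableSpace F] [BorelSpace F] in
/-- The support of `dη` lies in the support of `Dη`. [folklore] -/
theorem support_extDeriv_subset {k : ℕ} (η : F → F [⋀^Fin k]→L[ℝ] ℝ) :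
    support (extDeriv η) ⊆ support (fderiv ℝ η) := by
  intro x hx h0
  apply hx
  rw [extDeriv, h0, ← ContinuousAlternatingMap.alternatizeUncurryFinCLM_apply, map_zero]

omit [FiniteDimensional ℝ F] [MeasurableSpace F] [BorelSpace F] in
/-- The closed support of `dη` lies in the closed support of `η`. [folklore] -/
theorem tsupport_extDeriv_subset {k : ℕ} (η : F → F [⋀^Fin k]→L[ℝ] ℝ) :
    tsupport (extDeriv η) ⊆ tsupport η :=
  (closure_mono (support_extDeriv_subset η)).trans (tsupport_fderiv_subset ℝ)

omit [FiniteDimensional ℝ F] [MeasurableSpace F] [BorelSpace F] in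
/-- The exterior derivative of a compactly supported form has compact support. [folklore] -/
theorem hasCompactSupport_extDeriv {k : ℕ} {η : F → F [⋀^Fin k]→L[ℝ] ℝ}
    (hηc : HasCompactSupport η) : HasCompactSupport (extDeriv η) :=
  (hηc.fderiv (𝕜 := ℝ)).mono (support_extDeriv_subset η)

/-- **Stokes on `ℝⁿ` without boundary**: for a compactly supported `C¹` form `η` of degree `k`
on a finite-dimensional real vector space and any `k + 1` vectors `v`, `∫ dη (v) = 0` against a
Haar measure (Lee (2013), proof of Thm. 16.11, case `M = ℝⁿ`: each term of
`dη (v) = ∑ᵢ (-1)ⁱ ∂_{vᵢ} η(v̂ᵢ)` integrates to zero). [cite: LeeSmoothManifolds2013, Thm. 16.11] -/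
theorem integral_extDeriv_apply_eq_zero {k : ℕ} {η : F → F [⋀^Fin k]→L[ℝ] ℝ}
    (hη : ContDiff ℝ 1 η) (hηc : HasCompactSupport η) (v : Fin (k + 1) → F) :
    ∫ x, extDeriv η x v ∂μ = 0 := by
  have happly : ∀ w : Fin k → F, ContDiff ℝ 1 fun x ↦ η x w := fun w ↦
    contDiff_iff_contDiffAt.2 fun x ↦
      ContDiffAt.continuousAlternatingMap_apply_const hη.contDiffAt w
  have hsupp : ∀ w : Fin k → F, HasCompactSupport fun x ↦ η x w := fun w ↦
    hηc.mono fun x hx ↦ by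
      rw [mem_support] at hx ⊢
      contrapose! hx
      rw [hx, ContinuousAlternatingMap.coe_zero, Pi.zero_apply]
  have hint : ∀ i : Fin (k + 1), Integrable
      (fun x ↦ (-1 : ℝ) ^ (i : ℕ) * fderiv ℝ (fun x ↦ η x (i.removeNth v)) x (v i)) μ := by
    intro i
    refine (Continuous.integrable_of_hasCompactSupport ?_
      ((hsupp _).fderiv_apply (𝕜 := ℝ) (v i))).const_mul _
    exact ((happly _).continuous_fderiv one_ne_zero).clm_apply continuous_const
  have heq : (fun x ↦ extDeriv η x v) = fun x ↦
      ∑ i : Fin (k + 1), (-1 : ℝ) ^ (i : ℕ) * fderiv ℝ (fun x ↦ η x (i.removeNth v)) x (v i) := by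
    funext x
    rw [extDeriv_apply (hη.differentiable one_ne_zero x) v]
    refine Finset.sum_congr rfl fun i _ ↦ ?_
    simp only [zsmul_eq_mul, Int.cast_pow, Int.cast_neg, Int.cast_one]
  rw [heq, integral_finsetSum _ fun i _ ↦ hint i]
  refine Finset.sum_eq_zero fun i _ ↦ ?_
  rw [integral_const_mul, integral_fderiv_apply_eq_zero μ (happly _) (hsupp _), mul_zero]

end Flat

/-! ### Sums of smooth forms and their exterior derivatives; exact forms are derivatives -/

section Sums

variable {E : Type*} [NormedAddCommGroup E] [NormedSpace ℝ E]
  {H : Type*} [TopologicalSpace H] {I : ModelWithCorners ℝ E H}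
  {M : Type*} [TopologicalSpace M] [ChartedSpace H M]
  {F : Type*} [NormedAddCommGroup F] [NormedSpace ℝ F] {k : ℕ}

/-- The exterior derivative of a finite sum of smooth forms is the sum of the exterior
derivatives (Warner (1983), Thm. 2.20(1), iterated). [cite: WarnerGTM94, Thm. 2.20] -/
theorem mextDeriv_finset_sum {ι : Type*} (s : Finset ι)
    {γ : ι → Literature.Geometry.Kaehler.MForm I M F k}
    (hγ : ∀ i ∈ s, Literature.Geometry.Kaehler.IsSmoothForm (γ i)) :
    Literature.Geometry.Kaehler.mextDeriv (∑ i ∈ s, γ i) =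
      ∑ i ∈ s, Literature.Geometry.Kaehler.mextDeriv (γ i) := by
  classical
  induction s using Finset.induction_on with
  | empty => simp [Literature.Geometry.Kaehler.mextDeriv_zero]
  | insert a s ha ih =>
    have hs : ∀ i ∈ s, Literature.Geometry.Kaehler.IsSmoothForm (γ i) := fun i hi ↦
      hγ i (Finset.mem_insert_of_mem hi)
    rw [Finset.sum_insert ha, Finset.sum_insert ha,
      Literature.Geometry.Kaehler.mextDeriv_add (hγ a (Finset.mem_insert_self a s))
        ((Literature.Geometry.Kaehler.smoothForms I M F k).sum_mem hs), ih hs]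

/-- In positive degree, an exact smooth form is the exterior derivative of a smooth form: the
span in the definition of `exactSmoothForms` is already the image `d (smooth k-forms)`, `d` being
additive and homogeneous on smooth forms (Warner (1983), Def. 4.11). [cite: WarnerGTM94, Def. 4.11] -/
theorem exists_eq_mextDeriv_of_mem_exactSmoothForms
    {α : Literature.Geometry.Kaehler.MForm I M F (k + 1)}
    (hα : α ∈ Literature.Geometry.Kaehler.exactSmoothForms I M F (k + 1)) :
    ∃ β : Literature.Geometry.Kaehler.MForm I M F k,
      Literature.Geometry.Kaehler.IsSmoothForm β ∧ Literature.Geometry.Kaehler.mextDeriv β = α := by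
  rw [Literature.Geometry.Kaehler.exactSmoothForms] at hα
  refine Submodule.span_induction (p := fun α _ ↦ ∃ β : Literature.Geometry.Kaehler.MForm I M F k,
      Literature.Geometry.Kaehler.IsSmoothForm β ∧ Literature.Geometry.Kaehler.mextDeriv β = α)
    ?_ ?_ ?_ ?_ hα
  · rintro _ ⟨β, hβ, rfl⟩
    exact ⟨β, hβ, rfl⟩
  · exact ⟨0, Literature.Geometry.Kaehler.isSmoothForm_zero, Literature.Geometry.Kaehler.mextDeriv_zero⟩
  · rintro _ _ - - ⟨β, hβ, rfl⟩ ⟨γ, hγ, rfl⟩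
    exact ⟨β + γ, hβ.add hγ, Literature.Geometry.Kaehler.mextDeriv_add hβ hγ⟩
  · rintro c _ - ⟨β, hβ, rfl⟩
    exact ⟨c • β, hβ.smul c, Literature.Geometry.Kaehler.mextDeriv_smul c β⟩

end Sums

/-! ### Additivity of the integral over finite sums of smooth forms -/

section Additivity

variable {E : Type*} [NormedAddCommGroup E] [NormedSpace ℝ E] [FiniteDimensional ℝ E]
  {n : ℕ} [Fact (finrank ℝ E = n)]
  {H : Type*} [TopologicalSpace H] {I : ModelWithCorners ℝ E H}
  {M : Type*} [TopologicalSpace M] [ChartedSpace H M]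
  [MeasurableSpace E] [BorelSpace E] [T2Space M] [SigmaCompactSpace M] [IsManifold I ∞ M]
  (o : (x : M) → Orientation ℝ (TangentSpace I x) (Fin n))

/-- The integral of the zero top form vanishes (a special case of `MForm.integral_smul`; the
name `MForm.integral_zero` is taken by the flat-model statement of
`Literature/AlgebraicGeometry/Motives/HodgeDecomposition.lean`). [folklore] -/
theorem _root_.Literature.Geometry.Kaehler.MForm.zero_integral :
    (0 : Literature.Geometry.Kaehler.MForm I M ℝ n).integral o = 0 := by
  have := Literature.Geometry.Kaehler.MForm.integral_smul o (0 : ℝ)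
    (0 : Literature.Geometry.Kaehler.MForm I M ℝ n)
  rwa [zero_smul, zero_mul] at this

variable [CompactSpace M]

/-- **Additivity of the integral over finite sums** of smooth top forms (compact manifold,
continuous orientation family): `∫_M ∑ᵢ γᵢ = ∑ᵢ ∫_M γᵢ`, iterating the discharged named fact
`MForm.integral_add` (`MForm.integral_add_holds`, `FormIntegrationAddProofs`). Lee (2013),
Prop. 16.6(a). [cite: LeeSmoothManifolds2013, Prop. 16.6] -/
theorem _root_.Literature.Geometry.Kaehler.MForm.integral_finset_sum_of_isSmoothForm
    (ho : IsContinuousOrientation o) {ι : Type*} (s : Finset ι)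
    {γ : ι → Literature.Geometry.Kaehler.MForm I M ℝ n}
    (hγ : ∀ i ∈ s, Literature.Geometry.Kaehler.IsSmoothForm (γ i)) :
    (∑ i ∈ s, γ i).integral o = ∑ i ∈ s, (γ i).integral o := by
  classical
  induction s using Finset.induction_on with
  | empty => simp [Literature.Geometry.Kaehler.MForm.zero_integral]
  | insert a s ha ih =>
    have hs : ∀ i ∈ s, Literature.Geometry.Kaehler.IsSmoothForm (γ i) := fun i hi ↦
      hγ i (Finset.mem_insert_of_mem hi)
    rw [Finset.sum_insert ha, Finset.sum_insert ha,
      Literature.Geometry.Kaehler.MForm.integral_add_holds o ho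
        (hγ a (Finset.mem_insert_self a s))
        ((Literature.Geometry.Kaehler.smoothForms I M ℝ n).sum_mem hs), ih hs]

end Additivity

/-! ### Forms supported in one chart: `ψ • β = ofChart p η`, and Stokes in one chart -/

section OneChart

variable {E : Type*} [NormedAddCommGroup E] [NormedSpace ℝ E]
  {H : Type*} [TopologicalSpace H] {I : ModelWithCorners ℝ E H}
  {M : Type*} [TopologicalSpace M] [ChartedSpace H M] [IsManifold I ∞ M] [I.Boundaryless]
  {k : ℕ}

/-- **A form supported in a chart source is a chart pull-back.** If `ψ : M → ℝ` is smooth with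
compact support inside the source of the chart at `p` and `β` is a smooth `k`-form, then
`ψ • β = MForm.ofChart p η` for the form `η` on the model space equal to the chart representative
of `ψ • β` on the chart target and to `0` elsewhere; `η` is smooth with compact support inside
`extChartAt I p '' tsupport ψ`. (Lee (2013), proof of Thm. 16.11: a form supported in a single
chart is computed through `(φ⁻¹)^* ω`.) [cite: LeeSmoothManifolds2013, Thm. 16.11] -/
theorem exists_ofChart_eq_smul (p : M) {ψ : M → ℝ} (hψ : ContMDiff I 𝓘(ℝ) ∞ ψ)
    (hψc : HasCompactSupport ψ) (hψs : tsupport ψ ⊆ (extChartAt I p).source)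
    {β : Literature.Geometry.Kaehler.MForm I M ℝ k} (hβ : Literature.Geometry.Kaehler.IsSmoothForm β) :
    ∃ η : E → E [⋀^Fin k]→L[ℝ] ℝ, ContDiff ℝ ∞ η ∧ HasCompactSupport η ∧
      tsupport η ⊆ extChartAt I p '' tsupport ψ ∧
      (Literature.Geometry.Kaehler.MForm.ofChart p η : Literature.Geometry.Kaehler.MForm I M ℝ k) =
        ψ • β := by
  set T := (extChartAt I p).target with hT
  set K := extChartAt I p '' tsupport ψ with hK
  have hKc : IsCompact K := hψc.image_of_continuousOn ((continuousOn_extChartAt p).mono hψs)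
  have hKt : K ⊆ T := by
    rintro _ ⟨x, hx, rfl⟩
    exact (extChartAt I p).map_source (hψs hx)
  set η : E → E [⋀^Fin k]→L[ℝ] ℝ := T.indicator ((ψ • β).inChart p) with hη
  have hη0 : ∀ y, y ∉ K → η y = 0 := by
    intro y hy
    by_cases hyT : y ∈ T
    · rw [hη, indicator_of_mem hyT]
      have hx : (extChartAt I p).symm y ∉ tsupport ψ := fun h ↦
        hy ⟨_, h, (extChartAt I p).right_inv hyT⟩
      ext v
      simp only [Literature.Geometry.Kaehler.MForm.inChart_apply, Pi.smul_apply',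
        image_eq_zero_of_notMem_tsupport hx, zero_smul, ContinuousAlternatingMap.coe_zero,
        Pi.zero_apply]
    · rw [hη, indicator_of_notMem hyT]
  have hηK : tsupport η ⊆ K :=
    closure_minimal (fun y hy ↦ by_contra fun h ↦ hy (hη0 y h)) hKc.isClosed
  refine ⟨η, ?_, HasCompactSupport.intro hKc hη0, hηK, ?_⟩
  · refine contDiff_iff_contDiffAt.2 fun y ↦ ?_
    by_cases hyT : y ∈ T
    · have heq : η =ᶠ[𝓝 y] (ψ • β).inChart p := by
        filter_upwards [(isOpen_extChartAt_target p).mem_nhds hyT] with y' hy'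
        rw [hη, indicator_of_mem hy']
      refine ContDiffAt.congr_of_eventuallyEq ?_ heq
      exact ((hβ.fun_smul hψ).contDiffOn_inChart p).contDiffAt
        ((isOpen_extChartAt_target p).mem_nhds hyT)
    · have hyK : y ∉ K := fun h ↦ hyT (hKt h)
      have heq : η =ᶠ[𝓝 y] fun _ ↦ 0 := by
        filter_upwards [hKc.isClosed.isOpen_compl.mem_nhds hyK] with y' hy'
        exact hη0 y' hy'
      exact contDiffAt_const.congr_of_eventuallyEq heq
  · funext x
    by_cases hx : x ∈ (extChartAt I p).source
    · have h3 : x ∈ (extChartAt I x).source ∩ (extChartAt I p).source ∩ (extChartAt I x).source :=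
        ⟨⟨mem_extChartAt_source x, hx⟩, mem_extChartAt_source x⟩
      ext v
      rw [Literature.Geometry.Kaehler.MForm.ofChart_apply_of_mem p η hx, hη,
        indicator_of_mem ((extChartAt I p).map_source hx),
        Literature.Geometry.Kaehler.MForm.inChart_apply_extChartAt _ hx]
      simp only [tangentCoordChange_comp h3, tangentCoordChange_self (mem_extChartAt_source x)]
    · rw [Literature.Geometry.Kaehler.MForm.ofChart_apply_of_notMem p η hx, Pi.smul_apply',
        image_eq_zero_of_notMem_tsupport fun h ↦ hx (hψs h), zero_smul]

variable [FiniteDimensional ℝ E] [MeasurableSpace E] [BorelSpace E] [T2Space M]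
  [SigmaCompactSpace M] [CompactSpace M]

/-- **Stokes' theorem for a form supported in one oriented chart.** On a closed manifold, let the
chart at `p` have constant sign `ε` on a set `B` of its target, let `ψ` be a smooth function
with `tsupport ψ` in the chart source and `extChartAt I p '' tsupport ψ ⊆ B`, and let `β` be a
smooth `m`-form (`finrank ℝ E = m + 1`). Then `d (ψ • β)` is a smooth top form and
`∫_M d (ψ • β) = 0`: writing `ψ • β = ofChart p η` (`exists_ofChart_eq_smul`),
`d (ofChart p η) = ofChart p (dη)` (`mextDeriv_ofChart`), and
`∫_M ofChart p (dη) = ε ∫ dη (e₁, …, eₙ) dλ = 0` by `MForm.integral_ofChart_smul` and the flat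
case `integral_extDeriv_apply_eq_zero`. Lee (2013), proof of Thm. 16.11 (single chart);
Warner (1983), 4.9 (5). [cite: LeeSmoothManifolds2013, Thm. 16.11] -/
theorem integral_mextDeriv_smul_eq_zero {m : ℕ} [Fact (finrank ℝ E = m + 1)]
    (o : (x : M) → Orientation ℝ (TangentSpace I x) (Fin (m + 1))) {p : M} {B : Set E} {ε : ℝ}
    (hBt : B ⊆ (extChartAt I p).target) (hsign : ∀ y ∈ B, chartSign o p y = ε)
    {ψ : M → ℝ} (hψ : ContMDiff I 𝓘(ℝ) ∞ ψ) (hψc : HasCompactSupport ψ)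
    (hψs : tsupport ψ ⊆ (extChartAt I p).source) (hψB : extChartAt I p '' tsupport ψ ⊆ B)
    {β : Literature.Geometry.Kaehler.MForm I M ℝ m} (hβ : Literature.Geometry.Kaehler.IsSmoothForm β) :
    Literature.Geometry.Kaehler.IsSmoothForm (Literature.Geometry.Kaehler.mextDeriv (ψ • β)) ∧
      (Literature.Geometry.Kaehler.mextDeriv (ψ • β)).integral o = 0 := by
  set e := modelBasis E (m + 1) with he
  set D := basisDetL e with hDdef
  have hD : D e = 1 := basisDetL_self e
  obtain ⟨η, hηs, hηc, hηK, hηeq⟩ := exists_ofChart_eq_smul p hψ hψc hψs hβ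
  have hηt : tsupport η ⊆ (extChartAt I p).target := hηK.trans (hψB.trans hBt)
  have hd : Literature.Geometry.Kaehler.mextDeriv (ψ • β) =
      Literature.Geometry.Kaehler.MForm.ofChart p (extDeriv η) := by
    rw [← hηeq, mextDeriv_ofChart p hηs hηc hηt]
  have hdη : ContDiff ℝ ∞ (extDeriv η) := contDiff_extDeriv hηs
  set g : E → ℝ := fun y ↦ extDeriv η y e with hg
  have hgD : extDeriv η = fun y ↦ g y • D := funext fun y ↦
    ContinuousAlternatingMap.eq_apply_basis_smul e (extDeriv η y) D hD
  have hgcont : Continuous g := (continuous_eval_const (⇑e : Fin (m + 1) → E)).comp hdη.continuous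
  have hgsupp : tsupport g ⊆ tsupport η := by
    refine (closure_mono fun y hy ↦ ?_).trans (tsupport_extDeriv_subset η)
    rw [mem_support] at hy ⊢
    contrapose! hy
    change extDeriv η y e = 0
    rw [hy, ContinuousAlternatingMap.coe_zero, Pi.zero_apply]
  have hgc : HasCompactSupport g :=
    IsCompact.of_isClosed_subset hηc (isClosed_tsupport _) hgsupp
  refine ⟨?_, ?_⟩
  · rw [hd]
    exact isSmoothForm_ofChart p hdη (hasCompactSupport_extDeriv hηc)
      ((tsupport_extDeriv_subset η).trans hηt)
  · rw [hd, hgD, Literature.Geometry.Kaehler.MForm.integral_ofChart_smul o p hD hgcont hgc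
      (hgsupp.trans hηt) (fun y hy ↦ hsign y (hψB (hηK (hgsupp hy))))]
    change ε * ∫ y, extDeriv η y e ∂e.addHaar = 0
    rw [integral_extDeriv_apply_eq_zero _ (hηs.of_le (by simp)) hηc, mul_zero]

end OneChart

/-! ### Stokes' theorem on a closed manifold -/

section Stokes

variable {E : Type*} [NormedAddCommGroup E] [NormedSpace ℝ E] [FiniteDimensional ℝ E]
  {H : Type*} [TopologicalSpace H] {I : ModelWithCorners ℝ E H}
  {M : Type*} [TopologicalSpace M] [ChartedSpace H M]
  [MeasurableSpace E] [BorelSpace E] [T2Space M] [SigmaCompactSpace M] [IsManifold I ∞ M]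
  [CompactSpace M] [I.Boundaryless]

/-- **Stokes' theorem on a closed oriented manifold** (Warner (1983), Corollary to Thm. 4.9;
Lee (2013), Thm. 16.11 with `∂M = ∅` / Cor. 16.13): on a compact boundaryless manifold with a
continuous orientation family `o`, for every smooth `m`-form `β` (`finrank ℝ E = m + 1`) the top
form `dβ` is smooth and `∫_M dβ = 0`. Proof: cover `M` by oriented coordinate balls
(`exists_chartSign_const_ball`), take a smooth partition of unity `{ψᵢ}` subordinate to them
(finitely many nonzero, `M` compact), write `dβ = ∑ᵢ d(ψᵢ β)` (`mextDeriv_finset_sum`),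
`∫_M ∑ᵢ = ∑ᵢ ∫_M` (`MForm.integral_finset_sum_of_isSmoothForm`) and `∫_M d(ψᵢ β) = 0`
(`integral_mextDeriv_smul_eq_zero`). [cite: WarnerGTM94, Thm. 4.9] -/
theorem integral_mextDeriv_eq_zero_of_isSmoothForm {m : ℕ} [Fact (finrank ℝ E = m + 1)]
    (o : (x : M) → Orientation ℝ (TangentSpace I x) (Fin (m + 1)))
    (ho : IsContinuousOrientation o) {β : Literature.Geometry.Kaehler.MForm I M ℝ m}
    (hβ : Literature.Geometry.Kaehler.IsSmoothForm β) :
    Literature.Geometry.Kaehler.IsSmoothForm (Literature.Geometry.Kaehler.mextDeriv β) ∧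
      (Literature.Geometry.Kaehler.mextDeriv β).integral o = 0 := by
  set A := (modelBasis E (m + 1)).equivFunL with hA
  choose r hr ε hε hsub hsign using exists_chartSign_const_ball o ho
  set V : M → Set M := fun p ↦ (extChartAt I p).source ∩ extChartAt I p ⁻¹'
    (A ⁻¹' Metric.ball (A (extChartAt I p p)) (r p)) with hV
  have hVopen : ∀ p, IsOpen (V p) := fun p ↦ (continuousOn_extChartAt p).isOpen_inter_preimage
    (isOpen_extChartAt_source p) (Metric.isOpen_ball.preimage A.continuous)
  have hpV : ∀ p, p ∈ V p := fun p ↦ ⟨mem_extChartAt_source p, by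
    simp only [mem_preimage, Metric.mem_ball, dist_self, hr p]⟩
  obtain ⟨ψ, hψ⟩ := SmoothPartitionOfUnity.exists_isSubordinate I isClosed_univ V hVopen
    (fun p _ ↦ mem_iUnion.2 ⟨p, hpV p⟩)
  have hfin : {i : M | (support (ψ i)).Nonempty}.Finite :=
    ψ.locallyFinite.finite_nonempty_of_compact
  set S := hfin.toFinset with hS
  have hSmem : ∀ i, i ∉ S → ∀ x, ψ i x = 0 := by
    intro i hi x
    by_contra hx
    exact hi (hfin.mem_toFinset.2 ⟨x, hx⟩)
  have hsum1 : ∀ x : M, ∑ i ∈ S, ψ i x = 1 := by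
    intro x
    have hsub' : support (fun i ↦ ψ i x) ⊆ (S : Set M) := by
      intro i hi
      simp only [Finset.mem_coe]
      by_contra h
      exact hi (hSmem i h x)
    exact (finsum_eq_sum_of_support_subset _ hsub').symm.trans (ψ.sum_eq_one (mem_univ x))
  have hβi : ∀ i, Literature.Geometry.Kaehler.IsSmoothForm ((ψ i : M → ℝ) • β) := fun i ↦
    Literature.Geometry.Kaehler.IsSmoothForm.fun_smul (ContMDiffMap.contMDiff (ψ i)) hβ
  have hβsum : ∑ i ∈ S, (ψ i : M → ℝ) • β = β := by
    funext x
    rw [Finset.sum_apply]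
    simp only [Pi.smul_apply']
    rw [← Finset.sum_smul, hsum1, one_smul]
  have hpiece : ∀ i,
      Literature.Geometry.Kaehler.IsSmoothForm
        (Literature.Geometry.Kaehler.mextDeriv ((ψ i : M → ℝ) • β)) ∧
      (Literature.Geometry.Kaehler.mextDeriv ((ψ i : M → ℝ) • β)).integral o = 0 := by
    intro i
    refine integral_mextDeriv_smul_eq_zero o (hsub i) (hsign i) (ContMDiffMap.contMDiff (ψ i))
      ((isClosed_tsupport _).isCompact) (fun x hx ↦ (hψ i hx).1) ?_ hβ
    rintro _ ⟨x, hx, rfl⟩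
    exact Metric.ball_subset_closedBall (hψ i hx).2
  rw [← hβsum, mextDeriv_finset_sum S fun i _ ↦ hβi i]
  refine ⟨(Literature.Geometry.Kaehler.smoothForms I M ℝ (m + 1)).sum_mem fun i _ ↦ (hpiece i).1,
    ?_⟩
  rw [Literature.Geometry.Kaehler.MForm.integral_finset_sum_of_isSmoothForm o ho S
    fun i _ ↦ (hpiece i).1]
  exact Finset.sum_eq_zero fun i _ ↦ (hpiece i).2

end Stokes

/-! ### The named facts -/

section Facts

variable {E : Type*} [NormedAddCommGroup E] [NormedSpace ℝ E] [FiniteDimensional ℝ E]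
  {n : ℕ} [Fact (finrank ℝ E = n)]
  {H : Type*} [TopologicalSpace H] {I : ModelWithCorners ℝ E H}
  {M : Type*} [TopologicalSpace M] [ChartedSpace H M]
  [MeasurableSpace E] [BorelSpace E] [T2Space M] [SigmaCompactSpace M] [IsManifold I ∞ M]
  (o : (x : M) → Orientation ℝ (TangentSpace I x) (Fin n))

/-- **Stokes' theorem on a closed manifold** — the named fact
`Literature.Geometry.Kaehler.MForm.integral_mextDeriv_eq_zero` holds: on a compact oriented
manifold without boundary (continuous orientation family), `∫_M dβ = 0` for every smooth
`(n-1)`-form `β`. Warner (1983), Thm. 4.9 with `∂M = ∅` (Corollary); Lee (2013), Thm. 16.11 /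
Cor. 16.13. [cite: WarnerGTM94, Thm. 4.9] -/
theorem _root_.Literature.Geometry.Kaehler.MForm.integral_mextDeriv_eq_zero_holds :
    Literature.Geometry.Kaehler.MForm.integral_mextDeriv_eq_zero o := by
  intro _ _ m h ho β hβ
  subst h
  exact (integral_mextDeriv_eq_zero_of_isSmoothForm o ho hβ).2

/-- **Exact smooth top forms integrate to zero on a closed manifold** — the named fact
`Literature.Geometry.Kaehler.MForm.integral_eq_zero_of_mem_exactSmoothForms` holds: on a compact
oriented manifold without boundary (continuous orientation family),
`α ∈ B^n(M) → ∫_M α = 0`. In degree `0` the exact forms are `{0}`; in degree `m + 1` an exact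
smooth form is `dβ` for a smooth `β` (`exists_eq_mextDeriv_of_mem_exactSmoothForms`) and
`∫_M dβ = 0` by Stokes. Warner (1983), Corollary to Thm. 4.9; Lee (2013), Cor. 16.13.
[cite: WarnerGTM94, Thm. 4.9] -/
theorem _root_.Literature.Geometry.Kaehler.MForm.integral_eq_zero_of_mem_exactSmoothForms_holds :
    Literature.Geometry.Kaehler.MForm.integral_eq_zero_of_mem_exactSmoothForms o := by
  intro _ _ ho α hα
  cases n with
  | zero =>
    rw [Literature.Geometry.Kaehler.exactSmoothForms, Submodule.mem_bot] at hα
    rw [hα]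
    exact Literature.Geometry.Kaehler.MForm.zero_integral o
  | succ m =>
    obtain ⟨β, hβ, rfl⟩ := exists_eq_mextDeriv_of_mem_exactSmoothForms hα
    exact (integral_mextDeriv_eq_zero_of_isSmoothForm o ho hβ).2

end Facts

end Literature.NumberTheory.Transcendental
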